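import Summits.QuantumFields.BalabanUV.Beta.GAN24.RespStepBmDecompPsi
import Summits.QuantumFields.BalabanUV.Beta.AveragingPointsOfView

/-!
# `GAN24.PsiParentBlockMeans` — NESTED BLOCK SUMS, and: every term of the inter-block gauge term `Ψ` of the dressed composite legs has ZERO
# MEAN ON EVERY PARENT BLOCK; `blockSum (Lc^(k+1)) (Psi ρ Lc m k b) = 0`

HONEST FRAMING (cell charter, verbatim): «discharging `BetaPertH` makes Bałaban's UV stability UNCONDITIONAL — a real
constructive-QFT result; it is NOT the continuum limit and NOT the Clay problem.»  DERIVED cell leaf (pub-balaban, G-an2-4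
formalisation swarm → CRUX TEAM (2), seat `b2b-balaban-gan24-formalise-leaf-02`, gen 45; toward the row owner's INTERFACE REQUEST G-an2-4 of
2026-08-21T10:11Z ∕ 11:17Z, whose supplier of record for the recursive first-order family is the CONTACT-TERM ROUTE `CT-ROUTE-v1.md`): the
refuter's residual (r-iii) of PRICING-GAN24 v3.8 cell C-R8° — «the `Psi_succ` lift preserving zero parent-block means», used by CT-2 (the
accumulated gauge is a bounded zero-mean multi-scale sawtooth) and CT-4a (weak second-order effect of a zero-mean comb) — as kernel theorems.
[folklore] finite bookkeeping over `AffineAveraging.blockSum` ∕ `box` ∕ `toSite`, `AveragingContours.blk` ∕ `blk_block`, an2's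
`AxialProjectorBlockMean.bmGaugeAt` with cap3∕an2's `AveragingPointsOfView.blockSum_bmGaugeAt`, and leaf-03's displayed `RespStepBmDecompPsi.Psi`
(BY NAME; nothing restated).  Nothing cited, no `[cite:]` tag, no `def`, no `def … : Prop`, no estimate, no limit, 0 sorry; it instantiates NO
binder of the β-function wall and discharges NO letter of (CONV-C).  NEVER «G-an2-4 closed»; NOT hSrow, NOT D1, NOT `BetaPertH`, NOT continuum,
NOT Clay.  «not in print; our bookkeeping».
HONEST DEPENDENCY (cell records, verbatim): «continuum YM on T⁴ ⇐ BetaPertH ∧ nine spine estimates (0/9 proved); BetaPertH ⇐ (D1) ∧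
(D4) ∧ CAP+tail; G-an2-4 gates asym, D1 and NE2/3/4.»
ABSOLUTE RULE (cell charter, verbatim): «No internally-minted statement may enter as a cited fact. Every hypothesis is either
kernel-proved in this package or a verbatim quotation of a PUBLISHED theorem with page reference. The manuscript(s) under audit are
NOT citable for their own disputed steps — they are the thing under adjudication; programme-internal (2001/route/tribunal) claims are
never citable.»

WHAT IS HERE ([folklore]; `n` = lattice dimension, `Form0 n ℝ` site functions on `ℤ^n`).
* §1 NESTED BLOCK SUMS (not in the tree before): `mem_box_iff`; **`blockSum_mul : blockSum (M·L) f Y = Σ_{c ∈ box L} blockSum M f (L•Y + c)`**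
  (`1 ≤ M`; the block of side `M·L` labelled `Y` is the disjoint union of the `L^n` blocks of side `M` labelled by the block of side `L` over `Y`;
  reindexing `box L ×ˢ box M ≃ box (M·L)`, `(c, r) ↦ M•c + r`, `Finset.sum_nbij'` with coordinatewise Euclidean division);
  **`blockSum_comp_blk_mul : blockSum (M·L) (g ∘ blk M) Y = M^n · blockSum L g Y`** (a function read through the `M`-block label contributes `M^n`
  copies per block, `blk_block`); `blockSum_comp_blk_eq_zero` (zero `L`-block sums lift to zero `(M·L)`-block sums).
* §2 THE PARENT-BLOCK MEANS OF `Ψ` (`Psi ρ Lc m k b x = −Σ_{i<k} (Lc^{(d+1)(i+1)})⁻¹·bmGaugeAt ρ (R_i b) Lc (blk (Lc^(i+1)) x)`, leaf-03's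
  `RespStepBmDecompPsi.Psi_apply`): **`blockSum_bmGaugeAt_comp_blk : blockSum (Lc^(i+2)) (fun x => bmGaugeAt ρ A Lc (blk (Lc^(i+1)) x)) = 0`** for
  EVERY root `ρ` and every 1-form `A` (the `i`-th term, block-constant on `Lc^(i+1)`-blocks, has zero mean on every PARENT `Lc^(i+2)`-block, by
  `blockSum_bmGaugeAt` + §1); `blockSum_bmGaugeAt_comp_blk_of_le` (every coarser scale `Lc^j`, `j ≥ i + 2`); and
  **`blockSum_Psi : blockSum (Lc^(k+1)) (Psi ρ Lc m k b) = 0`** — the whole inter-block gauge term has zero mean on every block of the source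
  scale `Lc^(k+1)` (every `m k b ρ`; no summability, no root hypothesis).
NOT HERE: any bound on `Ψ` (CT-2's sup bound needs the leg-sup letters of the undressed responses in the owner's currency); the gauge pieces'
means over blocks FINER than their own scale are not zero and nothing is claimed about them.
Provenance: seat b2b-balaban-gan24-formalise-leaf-02 gen 45 (prover-…-leaf-02-g45-0), 2026-08-21; over the files named above BY NAME.
-/

noncomputable section

open Finset
open scoped BigOperators
open Literature.MathematicalPhysics.QuantumFieldTheory
open Literature.MathematicalPhysics.QuantumFieldTheory.Balaban1983to89
open Literature.MathematicalPhysics.QuantumFieldTheory.Balaban1983to89.Beta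
open AffineAveraging (Form0 Form1 Site box toSite blockSum)
open AveragingContours (blk blk_block)
open Summit.QuantumFields.BalabanUV.Beta.AxialProjectorBlockMean (bmGaugeAt)
open Summit.QuantumFields.BalabanUV.Beta.AveragingPointsOfView (blockSum_bmGaugeAt)
open Summit.QuantumFields.BalabanUV.Beta.GAN24.RespStepBmDecompPsi (Psi Psi_apply)

namespace Summit.QuantumFields.BalabanUV.Beta.GAN24.PsiParentBlockMeans

variable {n : ℕ}

/-! ## §1 Nested block sums -/

/-- [folklore] membership in `box`, coordinatewise. -/
theorem mem_box_iff {L : ℕ} {b : Fin n → ℕ} : b ∈ box n L ↔ ∀ i, b i < L := by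
  simp [AffineAveraging.box, Fintype.mem_piFinset, Finset.mem_range]

/-- [folklore] **NESTED BLOCK SUMS**: a block of side `M·L` is the disjoint union of the `L^n` blocks of side `M` labelled by the block of side `L`:
`blockSum (M·L) f Y = Σ_{c ∈ box L} blockSum M f (L•Y + c)`. -/
theorem blockSum_mul {M : ℕ} (hM : 1 ≤ M) (L : ℕ) (f : Form0 n ℝ) (Y : Site n) :
    blockSum (M * L) f Y = ∑ c ∈ box n L, blockSum M f ((L : ℤ) • Y + toSite c) := by
  unfold AffineAveraging.blockSum
  rw [← Finset.sum_product']
  -- reindex `box L ×ˢ box M ≃ box (M·L)` by `(c, r) ↦ M•c + r`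
  symm
  refine Finset.sum_nbij' (fun p => fun i => M * p.1 i + p.2 i) (fun b => (fun i => b i / M, fun i => b i % M)) ?_ ?_ ?_ ?_ ?_
  · intro p hp
    rw [Finset.mem_product] at hp
    rw [mem_box_iff]
    intro i
    have h1 := (mem_box_iff.mp hp.1) i
    have h2 := (mem_box_iff.mp hp.2) i
    calc M * p.1 i + p.2 i < M * p.1 i + M := by omega
      _ = M * (p.1 i + 1) := by ring
      _ ≤ M * L := Nat.mul_le_mul_left M h1
  · intro b hb
    rw [Finset.mem_product, mem_box_iff, mem_box_iff]
    have hb' := mem_box_iff.mp hb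
    refine ⟨fun i => ?_, fun i => Nat.mod_lt _ hM⟩
    have h := hb' i
    exact Nat.div_lt_of_lt_mul (by simpa [Nat.mul_comm] using h)
  · intro p hp
    rw [Finset.mem_product] at hp
    have h2 := mem_box_iff.mp hp.2
    ext i
    · show (M * p.1 i + p.2 i) / M = p.1 i
      rw [add_comm, Nat.add_mul_div_left _ _ hM, Nat.div_eq_of_lt (h2 i), zero_add]
    · show (M * p.1 i + p.2 i) % M = p.2 i
      rw [add_comm, Nat.add_mul_mod_self_left, Nat.mod_eq_of_lt (h2 i)]
  · intro b _
    funext i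
    exact Nat.div_add_mod (b i) M
  · intro p _
    congr 1
    funext i
    simp only [toSite, Pi.add_apply, Pi.smul_apply, smul_eq_mul, Nat.cast_add, Nat.cast_mul]
    ring

/-- [folklore] **THE BLOCK SUM OF A LIFTED BLOCK FUNCTION**: `blockSum (M·L) (g ∘ blk M) Y = M^n · blockSum L g Y` — a function read through the
`M`-block label is constant on `M`-blocks, each contributing `M^n` copies. -/
theorem blockSum_comp_blk_mul {M : ℕ} (hM : 1 ≤ M) (L : ℕ) (g : Form0 n ℝ) (Y : Site n) :
    blockSum (M * L) (fun x => g (blk M x)) Y = ((M : ℝ) ^ n) * blockSum L g Y := by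
  rw [blockSum_mul hM L]
  unfold AffineAveraging.blockSum
  rw [Finset.mul_sum]
  refine Finset.sum_congr rfl fun c _ => ?_
  have h : ∀ r ∈ box n M, g (blk M ((M : ℤ) • ((L : ℤ) • Y + toSite c) + toSite r)) = g ((L : ℤ) • Y + toSite c) := by
    intro r hr; rw [blk_block _ hr]
  rw [Finset.sum_congr rfl h, Finset.sum_const, nsmul_eq_mul]
  congr 1
  rw [AffineAveraging.box, Fintype.card_piFinset]
  simp

/-- [folklore] **ZERO BLOCK MEANS LIFT TO ZERO PARENT-BLOCK MEANS**: if `g` has zero `L`-block sums, then `g ∘ blk M` has zero `(M·L)`-block sums. -/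
theorem blockSum_comp_blk_eq_zero {M : ℕ} (hM : 1 ≤ M) {L : ℕ} {g : Form0 n ℝ} (hg : blockSum L g = 0) :
    blockSum (M * L) (fun x => g (blk M x)) = 0 := by
  funext Y
  rw [blockSum_comp_blk_mul hM L g Y, hg, Pi.zero_apply, mul_zero]

/-! ## §2 The parent-block means of the terms of `Psi` -/

variable {d : ℕ} {Lc : ℕ} [NeZero Lc]

/-- [folklore] **EACH TERM OF `Psi` HAS ZERO MEAN ON EVERY PARENT BLOCK** (the refuter's residual (r-iii) of PRICING-GAN24 v3.8 C-R8°, in the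
kernel): the level-`(i+1)` block-mean-normalised rooted tree gauge `bmGaugeAt ρ A Lc` (zero `Lc`-block sums, `blockSum_bmGaugeAt`), read through the
block label `blk (Lc^(i+1))`, has zero `Lc^(i+2)`-block sums on the fine lattice — for EVERY 1-form `A` and every root `ρ`. -/
theorem blockSum_bmGaugeAt_comp_blk (ρ : Site (d + 1)) (A : Form1 (d + 1) ℝ) (i : ℕ) :
    blockSum (Lc ^ (i + 2)) (fun x => bmGaugeAt ρ A Lc (blk (Lc ^ (i + 1)) x)) = 0 := by
  have hLc : 1 ≤ Lc := Nat.one_le_iff_ne_zero.2 (NeZero.ne Lc)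
  rw [pow_succ]
  exact blockSum_comp_blk_eq_zero (Nat.one_le_pow _ _ hLc) (blockSum_bmGaugeAt hLc ρ A)

/-- [folklore] … and hence zero `Lc^(j)`-block sums for EVERY coarser scale `j ≥ i + 2` (a coarser block is a union of parent blocks, `blockSum_mul`). -/
theorem blockSum_bmGaugeAt_comp_blk_of_le (ρ : Site (d + 1)) (A : Form1 (d + 1) ℝ) {i j : ℕ} (hij : i + 2 ≤ j) :
    blockSum (Lc ^ j) (fun x => bmGaugeAt ρ A Lc (blk (Lc ^ (i + 1)) x)) = 0 := by
  have hLc : 1 ≤ Lc := Nat.one_le_iff_ne_zero.2 (NeZero.ne Lc)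
  obtain ⟨k, rfl⟩ := Nat.exists_eq_add_of_le hij
  funext Y
  rw [pow_add, blockSum_mul (Nat.one_le_pow _ _ hLc), Pi.zero_apply]
  refine Finset.sum_eq_zero fun c _ => ?_
  rw [blockSum_bmGaugeAt_comp_blk ρ A i, Pi.zero_apply]

/-- [folklore] **`Psi` HAS ZERO MEAN ON EVERY BLOCK OF THE SOURCE SCALE**: `blockSum (Lc^(k+1)) (Psi ρ Lc m k b) = 0` — every term `i < k` is a scalar
multiple of a lifted `bmGaugeAt` with zero `Lc^(i+2)`-block sums, and `i + 2 ≤ k + 1`. -/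
theorem blockSum_Psi (ρ : Site (d + 1)) (m k : ℕ) (b : Form1 (d + 1) ℝ) :
    blockSum (Lc ^ (k + 1)) (Psi ρ Lc m k b) = 0 := by
  funext Y
  rw [Pi.zero_apply]
  unfold AffineAveraging.blockSum
  simp only [Psi_apply, Finset.sum_neg_distrib, neg_eq_zero]
  rw [Finset.sum_comm]
  refine Finset.sum_eq_zero fun i hi => ?_
  rw [← Finset.mul_sum]
  have h := blockSum_bmGaugeAt_comp_blk_of_le (Lc := Lc) ρ (RespStepBmDecompLegs.legAct (BalabanCompositeJets.respStep (d := d) (Lc ^ (m + i + 1)) (Lc ^ (m + k + 1))) b)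
    (i := i) (j := k + 1) (by have := Finset.mem_range.mp hi; omega)
  have h' := congr_fun h Y
  rw [Pi.zero_apply] at h'
  unfold AffineAveraging.blockSum at h'
  rw [h', mul_zero]

end Summit.QuantumFields.BalabanUV.Beta.GAN24.PsiParentBlockMeans

end
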